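/-
HONEST FRAMING: exact (Metropolis-corrected) sampling algorithms for lattice gauge theory; figures of merit
are autocorrelation/cost numbers at stated couplings and volumes; no continuum-physics claim.
-/
import Mathlib
import Summits.Ventures.LatticeQCDFlow.TrivializingMaps.GradedMasses

/-!
# Emission estimates for the step of the graded Lüscher series (THEORY-1 §19, step (6b))

Venture-side (`Summits/Ventures/LatticeQCDFlow/`), never `Literature/`.  For a generation `G` and its successor
`G.step` (`GradedData`): the transferred amount `c(m_j) ν_j` of a child `j = ⟨e', a, i, p, b, c, m'⟩` is at
most `ct_j = ‖zhalf i p‖ ‖P_{m'}(κ_c ⊗ xᵢ)‖ ‖P_{m'}(T_a β_c ⊗ T_a yᵢ)‖` (`Gen.cm_mul_nu_le_ct`); summing over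
all children of the parent `i` produced at `(p, e')` gives the EMISSION bound (T2 of the tree's
`MassTransferContraction`) `∑ c(m_j) ν_j ≤ Γ · √((mᵢ)_{e'}) · νᵢ` with `Γ = n⁴ τ_* / 2` (`Gen.emit_le`:
re-grading loses nothing by `∑_{m'} ‖P_{m'} u‖‖P_{m'} w‖ ≤ ‖u‖‖w‖`, the colour cycles cost `n⁴`, the plaquette
generators cost `τ_*`, the old bra costs `√((mᵢ)_{e'})` by the derivative cost (E2)); children of a dead
parent and children produced at a link off their plaquette carry no mass.  0 sorry. [ours]
-/

namespace Summit.Ventures.LatticeQCDFlow.TrivializingMaps.GradedSeries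

open scoped ComplexConjugate Matrix Matrix.Norms.Frobenius InnerProductSpace ContDiff
open Finset
open Literature.MathematicalPhysics.QuantumFieldTheory
open Literature.MathematicalPhysics.QuantumFieldTheory.Luscher2010
open SlotRepresentation SlotCasimir SlotCoefficient SlotHilbert JointGrading CasimirGrading PlaquetteData
  SlotTensor TensorShift RankOne Vertex

variable {d L n : ℕ} [NeZero L]

/-- The vertex constant `Γ = n⁴ τ_* / 2`. [ours] -/
noncomputable def Gam (n : ℕ) (B : SuBasis n) : ℝ := (n : ℝ) ^ 4 * tauStar B / 2

/-- `Γ ≥ 0`. [ours] -/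
theorem Gam_nonneg (B : SuBasis n) : 0 ≤ Gam n B := by
  unfold Gam; have := tauStar_nonneg B; positivity

/-! ## The children: transferred amounts, emission, dead parents, off-plaquette links -/

namespace Gen
variable {B : SuBasis n} {σ : Type} [Fintype σ] [DecidableEq σ] (G : Gen (d := d) (L := L) B σ)

omit [NeZero L] in
/-- `‖zhalf i p‖ ≤ ‖zᵢ‖/2`. [ours] -/
theorem norm_zhalf_le (i : G.I) (p : Site d L × Fin d × Fin d) : ‖G.zhalf i p‖ ≤ ‖G.z i‖ / 2 := by
  unfold zhalf
  split_ifs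
  · rw [norm_mul, Complex.norm_real, Real.norm_of_nonneg (by norm_num : (0 : ℝ) ≤ 1 / 2)]
    linarith [norm_nonneg (G.z i)]
  · rw [norm_zero]; positivity

omit [NeZero L] in
/-- `zhalf i p = 0` for a dead parent (`zᵢ = 0`). [ours] -/
theorem zhalf_eq_zero {i : G.I} (h : G.z i = 0) (p : Site d L × Fin d × Fin d) : G.zhalf i p = 0 := by
  unfold zhalf; rw [h]; simp

/-- `c · ‖zdiv c w‖ ≤ ‖w‖` (`c ≥ 0`). [ours] -/
theorem mul_norm_zdiv_le {c : ℝ} (hc : 0 ≤ c) (w : ℂ) : c * ‖zdiv c w‖ ≤ ‖w‖ := by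
  unfold zdiv
  split_ifs with h
  · rw [norm_zero, mul_zero]; exact norm_nonneg _
  · rw [norm_mul, Complex.norm_real, Real.norm_of_nonneg (inv_nonneg.2 hc), ← mul_assoc,
      mul_inv_cancel₀ h, one_mul]

/-- The transferred amount bound of a child `⟨e', a, i, p, b, c, m'⟩` BEFORE summation:
`ct = ‖zhalf i p‖ · ‖P_{m'}(κ_c ⊗ xᵢ)‖ · ‖P_{m'}(T_a β_c ⊗ T_a yᵢ)‖`. [ours] -/
noncomputable def ct (e' : Edge d L) (a : B.ι) (i : G.I) (p : Site d L × Fin d × Fin d) (b : Bool)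
    (c : Fin n × Fin n × Fin n × Fin n) (mo : G.CModes i p b) : ℝ :=
  ‖G.zhalf i p‖ * (‖jointProj (casimirFamily (G.clnk i p) (G.cpol i b) B) mo (G.cx i c)‖
    * ‖jointProj (casimirFamily (G.clnk i p) (G.cpol i b) B) mo (G.cv e' a i p b c)‖)

omit [NeZero L] in
/-- `ct ≥ 0`. [ours] -/
theorem ct_nonneg (e' : Edge d L) (a : B.ι) (i : G.I) (p : Site d L × Fin d × Fin d) (b : Bool)
    (c : Fin n × Fin n × Fin n × Fin n) (mo : G.CModes i p b) : 0 ≤ G.ct e' a i p b c mo := by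
  unfold ct; positivity

/-- **(T1) for a child**: `c(m_j) · ν_j ≤ ct_j`. [ours] -/
theorem cm_mul_nu_le_ct (e' : Edge d L) (a : B.ι) (i : G.I) (p : Site d L × Fin d × Fin d) (b : Bool)
    (c : Fin n × Fin n × Fin n × Fin n) (mo : G.CModes i p b) :
    G.step.cm ⟨e', a, i, p, b, c, mo⟩ * G.step.nu ⟨e', a, i, p, b, c, mo⟩ ≤ G.ct e' a i p b c mo := by
  have hc : 0 ≤ G.step.cm ⟨e', a, i, p, b, c, mo⟩ := modeC_nonneg _ _ B _
  have h1 : G.step.cm ⟨e', a, i, p, b, c, mo⟩ * ‖G.step.z ⟨e', a, i, p, b, c, mo⟩‖ ≤ ‖G.zhalf i p‖ :=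
    mul_norm_zdiv_le hc (G.zhalf i p)
  unfold nu ct
  rw [← mul_assoc]
  exact mul_le_mul_of_nonneg_right h1 (by positivity)

omit [NeZero L] in
/-- `‖κ_c ⊗ xᵢ‖ = ‖xᵢ‖`. [ours] -/
theorem norm_cx (i : G.I) (c : Fin n × Fin n × Fin n × Fin n) : ‖G.cx i c‖ = ‖G.x i‖ := by
  unfold cx; rw [norm_tens, norm_pv, one_mul]

omit [NeZero L] in
/-- `‖T_a β_c ⊗ T_a yᵢ‖ ≤ ‖T_a^{Q_{p,b},e'}‖ · √((mᵢ)_{e'}) ‖yᵢ‖`. [ours] -/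
theorem norm_cv_le (e' : Edge d L) (a : B.ι) (i : G.I) (p : Site d L × Fin d × Fin d) (b : Bool)
    (c : Fin n × Fin n × Fin n × Fin n) :
    ‖G.cv e' a i p b c‖
      ≤ ‖genCLM (plaqIdx p.1 p.2.1 p.2.2) (polB b) e' (B.T a)‖ * (G.wt i e' * ‖G.y i‖) := by
  unfold cv
  rw [norm_tens]
  refine mul_le_mul ?_ ?_ (norm_nonneg _) (norm_nonneg _)
  · refine (ContinuousLinearMap.le_opNorm _ _).trans (le_of_eq ?_)
    rw [norm_pv, mul_one]
  · exact norm_genCLM_jointProj_le (G.lnk i) (G.pol i) B (G.m i) e' a (G.v i)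

/-- Summing `ct` over the child modes: `∑_{m'} ct ≤ ‖zhalf‖ ‖xᵢ‖ ‖T_a^{Q_{p,b},e'}‖ √((mᵢ)_{e'}) ‖yᵢ‖`.
[ours] -/
theorem sum_ct_le (e' : Edge d L) (a : B.ι) (i : G.I) (p : Site d L × Fin d × Fin d) (b : Bool)
    (c : Fin n × Fin n × Fin n × Fin n) :
    ∑ mo : G.CModes i p b, G.ct e' a i p b c mo
      ≤ ‖G.zhalf i p‖ * (‖G.x i‖
        * (‖genCLM (plaqIdx p.1 p.2.1 p.2.2) (polB b) e' (B.T a)‖ * (G.wt i e' * ‖G.y i‖))) := by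
  unfold ct
  rw [← Finset.mul_sum]
  refine mul_le_mul_of_nonneg_left ?_ (norm_nonneg _)
  refine (sum_norm_jointProj_mul_le (G.clnk i p) (G.cpol i b) B (G.cx i c) (G.cv e' a i p b c)).trans ?_
  rw [G.norm_cx i c]
  exact mul_le_mul_of_nonneg_left (G.norm_cv_le e' a i p b c) (norm_nonneg _)

/-- **(T2) EMISSION**: the children of parent `i` produced at `(p, e')` receive in total at most
`Γ · √((mᵢ)_{e'}) · νᵢ`. [ours] -/
theorem emit_le (i : G.I) (p : Site d L × Fin d × Fin d) (e' : Edge d L) :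
    ∑ a : B.ι, ∑ b : Bool, ∑ c : Fin n × Fin n × Fin n × Fin n, ∑ mo : G.CModes i p b,
        G.step.cm ⟨e', a, i, p, b, c, mo⟩ * G.step.nu ⟨e', a, i, p, b, c, mo⟩
      ≤ Gam n B * G.wt i e' * G.nu i := by
  -- replace every child amount by `ct`, sum the modes, then the colour cycles, then `(a, b)`
  set g : B.ι → Bool → ℝ := fun a b => ‖genCLM (plaqIdx p.1 p.2.1 p.2.2) (polB b) e' (B.T a)‖ with hg
  set K : ℝ := ‖G.zhalf i p‖ * (‖G.x i‖ * (G.wt i e' * ‖G.y i‖)) with hK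
  have hK0 : 0 ≤ K := by rw [hK]; have := G.wt_nonneg i e'; positivity
  have h1 : ∀ a b c, ∑ mo : G.CModes i p b,
      G.step.cm ⟨e', a, i, p, b, c, mo⟩ * G.step.nu ⟨e', a, i, p, b, c, mo⟩ ≤ K * g a b := by
    intro a b c
    refine (Finset.sum_le_sum fun mo _ => G.cm_mul_nu_le_ct e' a i p b c mo).trans ?_
    refine (G.sum_ct_le e' a i p b c).trans (le_of_eq ?_)
    rw [hK, hg]; ring
  have h2 : ∀ a b, ∑ c : Fin n × Fin n × Fin n × Fin n, ∑ mo : G.CModes i p b,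
      G.step.cm ⟨e', a, i, p, b, c, mo⟩ * G.step.nu ⟨e', a, i, p, b, c, mo⟩
        ≤ (n : ℝ) ^ 4 * (K * g a b) := by
    intro a b
    refine (Finset.sum_le_sum fun c _ => h1 a b c).trans (le_of_eq ?_)
    rw [Finset.sum_const, Finset.card_univ, nsmul_eq_mul]
    simp only [Fintype.card_prod, Fintype.card_fin]
    push_cast; ring
  have h3 : ∑ a : B.ι, ∑ b : Bool, (n : ℝ) ^ 4 * (K * g a b)
      = (n : ℝ) ^ 4 * K * ∑ b : Bool, ∑ a : B.ι, g a b := by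
    rw [Finset.sum_comm, Finset.mul_sum]
    refine Finset.sum_congr rfl fun b _ => ?_
    rw [Finset.mul_sum]
    refine Finset.sum_congr rfl fun a _ => ?_
    ring
  have h4 : ∑ b : Bool, ∑ a : B.ι, g a b ≤ tauStar B := by
    have := sum_genNorm_le_tauStar B (plaqIdx p.1 p.2.1 p.2.2) e'
    simpa only [genNorm, hg] using this
  calc ∑ a : B.ι, ∑ b : Bool, ∑ c : Fin n × Fin n × Fin n × Fin n, ∑ mo : G.CModes i p b,
        G.step.cm ⟨e', a, i, p, b, c, mo⟩ * G.step.nu ⟨e', a, i, p, b, c, mo⟩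
      ≤ ∑ a : B.ι, ∑ b : Bool, (n : ℝ) ^ 4 * (K * g a b) :=
        Finset.sum_le_sum fun a _ => Finset.sum_le_sum fun b _ => h2 a b
    _ = (n : ℝ) ^ 4 * K * ∑ b : Bool, ∑ a : B.ι, g a b := h3
    _ ≤ (n : ℝ) ^ 4 * K * tauStar B := mul_le_mul_of_nonneg_left h4 (by positivity)
    _ ≤ (n : ℝ) ^ 4 * (‖G.z i‖ / 2 * (‖G.x i‖ * (G.wt i e' * ‖G.y i‖))) * tauStar B := by
        have hz := G.norm_zhalf_le i p
        have ht := tauStar_nonneg B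
        have hw := G.wt_nonneg i e'
        rw [hK]
        gcongr
    _ = Gam n B * G.wt i e' * G.nu i := by unfold Gam nu; ring

/-- A child of a DEAD parent (`zᵢ = 0`) carries no mass. [ours] -/
theorem step_nu_eq_zero_of_z {i : G.I} (h : G.z i = 0) (e' : Edge d L) (a : B.ι)
    (p : Site d L × Fin d × Fin d) (b : Bool) (c : Fin n × Fin n × Fin n × Fin n) (mo : G.CModes i p b) :
    G.step.nu ⟨e', a, i, p, b, c, mo⟩ = 0 := by
  have hz : G.step.z ⟨e', a, i, p, b, c, mo⟩ = 0 := by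
    show zdiv (modeC (G.clnk i p) (G.cpol i b) B mo) (G.zhalf i p) = 0
    rw [G.zhalf_eq_zero h p]
    simp [zdiv]
  unfold nu; rw [hz, norm_zero, zero_mul]

/-- `tens 0 x₂ = 0`. [folklore] -/
theorem tens_zero_left {σ₁ σ₂ : Type*} [Fintype σ₁] [DecidableEq σ₁] [Fintype σ₂]
    [DecidableEq σ₂] (x₂ : SlotSpace σ₂ n) : tens (0 : SlotSpace σ₁ n) x₂ = 0 := by
  have h := tens_smul_left (0 : ℂ) (0 : SlotSpace σ₁ n) x₂
  rwa [zero_smul, zero_smul] at h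

/-- A child produced at a link `e'` OFF its plaquette carries no mass. [ours] -/
theorem step_nu_eq_zero_of_forall_ne {p : Site d L × Fin d × Fin d} {e' : Edge d L}
    (he : ∀ s, plaqIdx p.1 p.2.1 p.2.2 s ≠ e') (a : B.ι) (i : G.I) (b : Bool)
    (c : Fin n × Fin n × Fin n × Fin n) (mo : G.CModes i p b) :
    G.step.nu ⟨e', a, i, p, b, c, mo⟩ = 0 := by
  have hv : G.cv e' a i p b c = 0 := by
    unfold cv
    rw [genCLM_eq_zero_of_forall_ne (plaqIdx p.1 p.2.1 p.2.2) (polB b) he]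
    exact tens_zero_left _
  have hy : G.step.y ⟨e', a, i, p, b, c, mo⟩ = 0 := by
    show jointProj (casimirFamily (G.clnk i p) (G.cpol i b) B) mo (G.cv e' a i p b c) = 0
    rw [hv, map_zero]
  unfold nu; rw [hy, norm_zero, mul_zero, mul_zero]

end Gen

end Summit.Ventures.LatticeQCDFlow.TrivializingMaps.GradedSeries
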